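import Mathlib.Analysis.SpecialFunctions.Trigonometric.Series
import Summits.RiemannHypothesis.RiemannHypothesis.Theorems.LiHeightLawLogDefs
import Summits.RiemannHypothesis.RiemannHypothesis.Theorems.LiCoefficientsLiFarZeroTail
import Literature.NumberTheory.LFunctions.LittlewoodOscillationInputsAverageProofs
import HarnessLib

/-!
# RiemannHypothesis / LiHeightLog — crux `LiHeightBudgetLog` (closed budget inequality; RH-FREE)

Route `RiemannHypothesis/LiHeightLog` (cell `pub/rh-li`, round 6, dossier `theory/route/r6/README-R6.md`),
item `LiHeightBudgetLog`: for `T ≥ 1000` and `900 ≤ n ≤ 2T² log T`,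

  `2√n log n + liCoshDefect n T < liMainTerm n = (n/2) log n + C₁ n`,

`liCoshDefect n T = (cosh(n/2T²) − 1)(T(log(T/2π) + 1)/π + 1.24 log T + 18) + (n/2) log T/(4πT²)`.
A closed real inequality; RH-FREE PROOF-OF-DATA rung L-P(P1-log) of the RH ladder's column LI; nothing here bears
on the truth of RH.

Proof.  `C₁ = (γ − 1 − log 2π)/2 ≥ −1.25` (`γ > 1/2`, `log 2π ≤ 2`) and `2√n log n ≤ (n/15) log n` (`√n ≥ 30`), so
`liMainTerm n − 2√n log n ≥ n((13/30) log n − 1.25)`.  With `K(T) = T(log(T/2π) + 1)/π + 1.24 log T + 18 ≤ 0.0024 T²`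
and `log T ≤ 6 + T/1000`:
* LOW range `n ≤ T²`: `x = n/2T² ≤ 1/2`, `cosh x − 1 ≤ (9/16)x²` (`cosh x ≤ e^{x²/2}`, `e^y ≤ 1 + y + y²`),
  `x² ≤ n/(4T²)`, so the defect is `≤ 0.00034 n + 10⁻⁶ n`, against `n((13/30)·6 − 1.25)`;
* HIGH range `T² ≤ n ≤ 2T² log T`: `x ≤ log T`, `cosh x − 1 ≤ (T − 1)/2`, `K(T) ≤ T log T/π`, so the defect is
  `≤ T² log T/(2π) + (log T)²/(4π) ≤ 0.17 T² log T`, against `T²((13/15) log T − 1.25)`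
  (`log n ≥ 2 log T`, `log T ≥ 6`).
-/

noncomputable section

-- D-0017: `Summit.<S>.<S>.…` is the designed namespace of a single-problem summit.
set_option linter.dupNamespace false

open Real Set
open scoped Real

namespace Summit.RiemannHypothesis.RiemannHypothesis.Theorems.LiTheory

open Literature.NumberTheory.LFunctions
open FarZeroTail

namespace BudgetLog

/-! ### Numerical constants -/

/-- `C₁ ≥ −1.25` (`γ > 1/2`, `log 2π ≤ 2`). -/
theorem liC1_ge : (-1.25 : ℝ) ≤ liC1 := by
  have hγ := Real.one_half_lt_eulerMascheroniConstant
  have h2π := Literature.NumberTheory.LFunctions.LittlewoodAverage.log_two_pi_le_two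
  unfold liC1
  linarith

/-- `6 ≤ log x` for `x ≥ 404` (`e⁶ < 404`). -/
theorem six_le_log {x : ℝ} (hx : 404 ≤ x) : 6 ≤ Real.log x := by
  rw [Real.le_log_iff_exp_le (by linarith)]
  have he := Real.exp_one_lt_d9
  have h6 : Real.exp 6 = Real.exp 1 ^ 6 := by rw [← Real.exp_nat_mul]; norm_num
  rw [h6]
  exact le_trans (pow_le_pow_left₀ (by positivity) he.le 6) (by norm_num; linarith)

/-- `log T ≤ 6 + T/1000` for `T > 0` (`log T ≤ log 1000 + T/1000 − 1`, `log 1000 ≤ 7`). -/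
theorem log_le_lin {T : ℝ} (hT : 0 < T) : Real.log T ≤ 6 + T / 1000 := by
  have h1 : Real.log T ≤ Real.log 1000 + (T / 1000 - 1) := by
    have := Real.log_le_sub_one_of_pos (show 0 < T / 1000 by positivity)
    have hdiv : Real.log (T / 1000) = Real.log T - Real.log 1000 := Real.log_div hT.ne' (by norm_num)
    linarith
  have h7 : Real.log 1000 ≤ 7 := by
    rw [Real.log_le_iff_le_exp (by norm_num)]
    have he := Real.exp_one_gt_d9
    have h7 : Real.exp 7 = Real.exp 1 ^ 7 := by rw [← Real.exp_nat_mul]; norm_num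
    rw [h7]
    exact le_trans (by norm_num) (pow_le_pow_left₀ (by norm_num) he.le 7)
  linarith

/-- The band: `2√n log n ≤ (n/15) log n` for `n ≥ 900`. -/
theorem band_le {n : ℕ} (hn : 900 ≤ n) : 2 * Real.sqrt n * Real.log n ≤ (n : ℝ) * Real.log n / 15 := by
  have hn' : (900 : ℝ) ≤ n := by exact_mod_cast hn
  have hs : 30 ≤ Real.sqrt n := by
    have h30 : Real.sqrt ((30 : ℝ) ^ 2) = 30 := Real.sqrt_sq (by norm_num)
    rw [← h30]
    exact Real.sqrt_le_sqrt (by linarith)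
  have hss : Real.sqrt n * Real.sqrt n = n := Real.mul_self_sqrt (by positivity)
  have hlog : 0 ≤ Real.log n := Real.log_nonneg (by linarith)
  have hsq : Real.sqrt n ≤ n / 30 := by nlinarith
  nlinarith

/-- `liMainTerm n − 2√n log n ≥ n((13/30) log n − 1.25)` for `n ≥ 900`. -/
theorem main_sub_band_ge {n : ℕ} (hn : 900 ≤ n) :
    (n : ℝ) * (13 / 30 * Real.log n - 1.25) ≤ liMainTerm n - 2 * Real.sqrt n * Real.log n := by
  have h1 := band_le hn
  have h2 := liC1_ge
  have hn' : (0 : ℝ) ≤ n := Nat.cast_nonneg n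
  unfold liMainTerm
  nlinarith

/-- The constant factor `K(T) = T(log(T/2π) + 1)/π + 1.24 log T + 18` is `≥ 0` for `T ≥ 1000`. -/
theorem K_nonneg {T : ℝ} (hT : 1000 ≤ T) :
    0 ≤ T * (Real.log (T / (2 * π)) + 1) / π + 1.24 * Real.log T + 18 := by
  have hπ := Real.pi_lt_d2
  have hlog : 0 ≤ Real.log (T / (2 * π)) := Real.log_nonneg (by rw [le_div_iff₀ (by positivity)]; linarith)
  have hlogT : 0 ≤ Real.log T := Real.log_nonneg (by linarith)
  positivity

/-- `K(T) ≤ T log T/π` for `T ≥ 1000` (`log 2π ≥ 1.8`, `1.24 log T + 18 ≤ 0.8 T/π`). -/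
theorem K_le_mul_log {T : ℝ} (hT : 1000 ≤ T) :
    T * (Real.log (T / (2 * π)) + 1) / π + 1.24 * Real.log T + 18 ≤ T * Real.log T / π := by
  have hT0 : 0 < T := by linarith
  have hπ := Real.pi_lt_d2
  have hπ0 := Real.pi_pos
  have h2π := log_two_pi_ge
  have hlin := log_le_lin hT0
  have hdiv : Real.log (T / (2 * π)) = Real.log T - Real.log (2 * π) := Real.log_div hT0.ne' (by positivity)
  rw [hdiv, div_add' _ _ _ hπ0.ne', div_add' _ _ _ hπ0.ne', div_le_div_iff_of_pos_right hπ0]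
  nlinarith

/-- `K(T) ≤ 0.0024 T²` for `T ≥ 1000`. -/
theorem K_le_sq {T : ℝ} (hT : 1000 ≤ T) :
    T * (Real.log (T / (2 * π)) + 1) / π + 1.24 * Real.log T + 18 ≤ 0.0024 * T ^ 2 := by
  have hT0 : 0 < T := by linarith
  have hπ := Real.pi_gt_d2
  have hπ0 := Real.pi_pos
  have hlin := log_le_lin hT0
  refine (K_le_mul_log hT).trans ?_
  rw [div_le_iff₀ hπ0]
  nlinarith

/-- LOW-range cosh bound: `cosh x − 1 ≤ (9/16) x²` for `0 ≤ x ≤ 1/2`. -/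
theorem cosh_sub_one_le_low {x : ℝ} (h0 : 0 ≤ x) (h1 : x ≤ 1 / 2) :
    Real.cosh x - 1 ≤ 9 / 16 * x ^ 2 := by
  have hc := Real.cosh_le_exp_half_sq x
  have hx2 : x ^ 2 ≤ 1 / 4 := by nlinarith
  have hy : |x ^ 2 / 2| ≤ 1 := by rw [abs_of_nonneg (by positivity)]; linarith
  have he := (abs_le.1 (Real.abs_exp_sub_one_sub_id_le hy)).2
  nlinarith

/-- HIGH-range cosh bound: `cosh x − 1 ≤ (T − 1)/2` for `0 ≤ x ≤ log T`, `T > 0`. -/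
theorem cosh_sub_one_le_high {x T : ℝ} (hT : 0 < T) (h0 : 0 ≤ x) (h1 : x ≤ Real.log T) :
    Real.cosh x - 1 ≤ (T - 1) / 2 := by
  rw [Real.cosh_eq]
  have h2 : Real.exp x ≤ T := by
    calc Real.exp x ≤ Real.exp (Real.log T) := Real.exp_le_exp.2 h1
      _ = T := Real.exp_log hT
  have h3 : Real.exp (-x) ≤ 1 := Real.exp_le_one_iff.2 (by linarith)
  linarith

end BudgetLog

open BudgetLog

/-- **LOW range** `900 ≤ n ≤ T²` of the budget. -/
theorem liHeightBudgetLog_low (n : ℕ) (T : ℝ) (hT : 1000 ≤ T) (hn : 900 ≤ n) (hnT : (n : ℝ) ≤ T ^ 2) :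
    2 * Real.sqrt n * Real.log n + liCoshDefect n T < liMainTerm n := by
  have hT0 : 0 < T := by linarith
  have hπ := Real.pi_gt_d2
  have hπ0 := Real.pi_pos
  have hn' : (900 : ℝ) ≤ n := by exact_mod_cast hn
  have hn0 : (0 : ℝ) < n := by linarith
  have hlogn : 6 ≤ Real.log n := six_le_log (by linarith)
  have hlogT : 6 ≤ Real.log T := six_le_log (by linarith)
  have hlin := log_le_lin hT0
  have hmain := main_sub_band_ge hn
  -- the cosh factor
  set x : ℝ := (n : ℝ) / (2 * T ^ 2) with hx
  have hx0 : 0 ≤ x := by positivity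
  have hx1 : x ≤ 1 / 2 := by
    rw [hx, div_le_iff₀ (by positivity)]; linarith
  have hcosh := cosh_sub_one_le_low hx0 hx1
  have hx2 : x ^ 2 ≤ n / (4 * T ^ 2) := by
    have e : x ^ 2 = (n : ℝ) * n / (4 * T ^ 2 * T ^ 2) := by rw [hx]; ring
    rw [e, div_le_div_iff₀ (by positivity) (by positivity)]
    have : (n : ℝ) * n ≤ n * T ^ 2 := mul_le_mul_of_nonneg_left hnT hn0.le
    nlinarith [sq_nonneg T]
  -- the tail
  have hK0 := K_nonneg hT
  have hK := K_le_sq hT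
  have htail : liCoshTail n T ≤ 0.00034 * n := by
    unfold liCoshTail
    calc (Real.cosh (n / (2 * T ^ 2)) - 1) * (T * (Real.log (T / (2 * π)) + 1) / π + 1.24 * Real.log T + 18)
        ≤ (9 / 16 * (n / (4 * T ^ 2))) * (0.0024 * T ^ 2) :=
          mul_le_mul (hcosh.trans (by nlinarith)) hK hK0 (by positivity)
      _ = 0.0003375 * n := by field_simp; ring
      _ ≤ 0.00034 * n := by nlinarith
  -- the phase term
  have hphase : (n : ℝ) / 2 * (Real.log T / (4 * π * T ^ 2)) ≤ 0.000001 * n := by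
    have h1 : Real.log T / (4 * π * T ^ 2) ≤ 0.000002 := by
      rw [div_le_iff₀ (by positivity)]
      nlinarith
    nlinarith
  unfold liCoshDefect
  nlinarith

/-- **HIGH range** `T² ≤ n ≤ 2T² log T` of the budget. -/
theorem liHeightBudgetLog_high (n : ℕ) (T : ℝ) (hT : 1000 ≤ T) (hTn : T ^ 2 ≤ (n : ℝ))
    (hnlog : (n : ℝ) ≤ 2 * T ^ 2 * Real.log T) :
    2 * Real.sqrt n * Real.log n + liCoshDefect n T < liMainTerm n := by
  have hT0 : 0 < T := by linarith
  have hπ := Real.pi_gt_d2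
  have hπ0 := Real.pi_pos
  have hT2 : (1000000 : ℝ) ≤ T ^ 2 := by nlinarith
  have hn' : (1000000 : ℝ) ≤ n := hT2.trans hTn
  have hn : 900 ≤ n := by exact_mod_cast (show (900 : ℝ) ≤ n by linarith)
  have hn0 : (0 : ℝ) < n := by linarith
  have hlogT : 6 ≤ Real.log T := six_le_log (by linarith)
  have hlin := log_le_lin hT0
  have hlogn : 2 * Real.log T ≤ Real.log n := by
    have e : Real.log (T ^ 2) = 2 * Real.log T := by
      rw [Real.log_pow]; push_cast; ring
    rw [← e]
    exact Real.log_le_log (by positivity) hTn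
  have hmain := main_sub_band_ge hn
  -- the cosh factor
  set x : ℝ := (n : ℝ) / (2 * T ^ 2) with hx
  have hx0 : 0 ≤ x := by positivity
  have hx1 : x ≤ Real.log T := by
    rw [hx, div_le_iff₀ (by positivity)]; linarith
  have hcosh := cosh_sub_one_le_high hT0 hx0 hx1
  -- the tail
  have hK0 := K_nonneg hT
  have hK := K_le_mul_log hT
  have htail : liCoshTail n T ≤ T ^ 2 * Real.log T / (2 * π) := by
    unfold liCoshTail
    calc (Real.cosh (n / (2 * T ^ 2)) - 1) * (T * (Real.log (T / (2 * π)) + 1) / π + 1.24 * Real.log T + 18)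
        ≤ (T / 2) * (T * Real.log T / π) := mul_le_mul (hcosh.trans (by linarith)) hK hK0 (by positivity)
      _ = T ^ 2 * Real.log T / (2 * π) := by field_simp
  have htail' : liCoshTail n T ≤ 0.16 * (T ^ 2 * Real.log T) := by
    refine htail.trans ?_
    rw [div_le_iff₀ (by positivity)]
    nlinarith
  -- the phase term
  have hphase : (n : ℝ) / 2 * (Real.log T / (4 * π * T ^ 2)) ≤ 0.01 * (T ^ 2 * Real.log T) := by
    have hlogT' : Real.log T ≤ T := by linarith [Real.log_le_sub_one_of_pos hT0]
    have h1 : (n : ℝ) / 2 * (Real.log T / (4 * π * T ^ 2)) ≤ Real.log T * Real.log T / (4 * π) := by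
      have e : (n : ℝ) / 2 * (Real.log T / (4 * π * T ^ 2)) = n * Real.log T / (8 * π * T ^ 2) := by
        field_simp; ring
      rw [e, div_le_div_iff₀ (by positivity) (by positivity)]
      have : (n : ℝ) * Real.log T ≤ 2 * T ^ 2 * Real.log T * Real.log T :=
        mul_le_mul_of_nonneg_right hnlog (by linarith)
      nlinarith
    refine h1.trans ?_
    rw [div_le_iff₀ (by positivity)]
    nlinarith
  -- main term from `n ≥ T²`, `log n ≥ 2 log T`
  have hmain' : T ^ 2 * (13 / 15 * Real.log T - 1.25) ≤ (n : ℝ) * (13 / 30 * Real.log n - 1.25) := by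
    have h1 : 13 / 15 * Real.log T - 1.25 ≤ 13 / 30 * Real.log n - 1.25 := by linarith
    have h2 : 0 ≤ 13 / 15 * Real.log T - 1.25 := by linarith
    exact mul_le_mul hTn h1 h2 hn0.le
  unfold liCoshDefect
  nlinarith

/-- **Crux `LiHeightBudgetLog` (closed budget inequality of the logarithmic range; RH-FREE).**  For `T ≥ 1000` and
`900 ≤ n ≤ 2T² log T`: `2√n log n + liCoshDefect n T < liMainTerm n`.  Verbatim the registered signature of
item `LiHeightBudgetLog` of route `LiHeightLog`. -/
theorem liHeightBudgetLog_bound :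
    ∀ (n : ℕ) (T : ℝ), 1000 ≤ T → 900 ≤ n → (n : ℝ) ≤ 2 * T ^ 2 * Real.log T →
      2 * Real.sqrt n * Real.log n + liCoshDefect n T < liMainTerm n := by
  intro n T hT hn hlog
  rcases le_total (n : ℝ) (T ^ 2) with h | h
  · exact liHeightBudgetLog_low n T hT hn h
  · exact liHeightBudgetLog_high n T hT h hlog

end Summit.RiemannHypothesis.RiemannHypothesis.Theorems.LiTheory

end
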